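import Mathlib
import HarnessLib
import Summits.ValiantsHypothesis.ValiantsHypothesis.Theorems.LacunarySymmetroidMatrixDescartesProductPlusOneCloudMonotone

/-!
# ValiantsHypothesis / LacunarySymmetroid — crux `MatrixDescartes` (stmt-ValiantsHypothesis-18050, V1),
# LINE (A) «product_plus_one», floor `OneChangeFloorK3` in W-currency (EB2-W): the ρ_I = 1 cell has AT MOST TWO zeros of the log-Wronskian

Owner memo §14 (val-idea-25 g3): `Z₊(eulerNumerator d a l₀) ≤ Z₊(W(∏ fewnomial)) + 2m + 1` for every coupling, `W(P) = P·θ²P − (θP)²`, and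
off the poles `W(P)/P² = θΦ = Σ_j θφ_j` (`θ = x·d/dx`, `φ_j` the row's Euler ratio).  This file counts the zeros of `θΦ` in the first
interaction cell by a CONVEXITY SPLIT that is new and much shorter than the tower of ✓ `…OneRiserTower` / `…CloudMonotone`:

  `θΦ = s − n`,  `s = θφ` (the switched riser's SLOPE),  `n = θΠ = cloudP1` (the cloud's slope, `> 0`).

In the vocabulary of ✓ `…CloudDefs` (`p = e₁+1`, `q = e₁+e₂+2`, row `A − B x^p − C x^q`, `u = rowU`, `H_k = rowH k`, `ψ_k = rowPsi_k`; for the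
SWITCHED riser the same closed forms hold with `u < 0`, and `s = −ψ₁`, `θs = −ψ₂`, `θ²s = −ψ₃`):
* `rowPsi_slope_identity` — for EVERY row, `ψ₂² − ψ₁ψ₃ = u²·(−2u(H₂ + H₁²u)³ − p²q²(q−p)²·(Bx^p)(Cx^q)·(H₀u + 1))` [ring];
* ★ `riser_slope_logConcave` — a switched riser (`A ≥ 0`, `B, C ≥ 0`, `u < 0`) past its turning point (`ψ₁ < 0`, i.e. `s > 0`) has
  `ψ₁ψ₃ < ψ₂²`: the slope `s` is strictly LOG-CONCAVE in `log x` (`H₀u + 1 = A·u ≤ 0` makes both bracket terms nonnegative, the cube term positive);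
* `rowPsi_slope_sos` / ★ `puller_slope_logConvex` — an unswitched incoherent row has `ψ₂² ≤ ψ₁ψ₃`: `n_i = θψ_i` is LOG-CONVEX, by the certificate
  `ψ₁ψ₃ − ψ₂² = u²(H₂H₄ − H₃²) + u³(2γ³q⁶ + βγ²p²q²(6q² + (q−p)²) + β²γp²q²(6p² + (q−p)²) + 2β³p⁶) + 6H₁²H₂²u⁴ + 6H₁⁴H₂u⁵ + 2H₁⁶u⁶`
  (`β = Bx^p`, `γ = Cx^q`, `H₂H₄ − H₃² = βγp²q²(q−p)²`); `cloud_lcP1` — hence `cloudP2² ≤ cloudP1·cloudP3` for every weighted cloud;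
* ★ `riser_turning_persist` — the turning is permanent: `M = −ψ₁/(H₁u²) = (m − φ)·h` has `θM = h·(H₁H₃ − H₂²)/H₁² > 0`, so `ψ₁ ≤ 0` at `x₁`
  implies `ψ₁ < 0` on every `(x₁, x₂]` on which the riser stays switched;
* ★★ `oneRiser_slope_no_three_zeros` — ONE switched two-letter incoherent riser (`0 ≤ a`, `b, c > 0`) against ANY weighted cloud of unswitched
  incoherent trinomials/binomials: `s − n = −ψ₁^{riser} − cloudP1` does NOT vanish at three points `x₁ < x₂ < x₃` of a window on which the riser is
  switched and the cloud unswitched (`log s − log n` is strictly concave there: Rolle twice + strict antitonicity of `ψ₂/ψ₁ − P2/P1`).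
  So the ρ_I = 1 cell carries ≤ 2 zeros of `W(P)` per window — the EB2-W count of the cell — and, by ✓ `euler_roots_Icc_le_wronskian_roots_add_one`,
  ≤ 3 zeros of `eulerNumerator d a l₀` for EVERY coupling `l₀` (✓ `…CloudLine` was the bottom coupling); the line-currency wrapper is the next file.

HONEST FRAMING: a local cell count (one switched incoherent row, `a ≥ 0` used); several switched rows, coherent/one-signed company and the budget
law stay OPEN; NOT `OneChangeFloorK3` / the stubs / `MatrixDescartes` / B; `VP ≠ VNP` NOT proved.  No definitions, no named facts.
-/

set_option linter.dupNamespace false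

namespace Summit.ValiantsHypothesis.ValiantsHypothesis.Theorems.LacunarySymmetroidMatrixDescartes

namespace ProductPlusOne

open Finset
open scoped BigOperators

/-! ### §1 One row: the slope certificates -/

section Row

variable (e₁ e₂ : ℕ) (A B C : ℝ)

/-- **Slope identity** (every row, no sign hypothesis): with `β = Bx^p`, `γ = Cx^q`,
`ψ₂² − ψ₁ψ₃ = u²·(−2u(H₂ + H₁²u)³ − p²q²(q−p)²·βγ·(H₀u + 1))`. [this file's lemma] -/
theorem rowPsi_slope_identity (x : ℝ) :
    rowPsi2 e₁ e₂ A B C x ^ 2 - rowPsi1 e₁ e₂ A B C x * rowPsi3 e₁ e₂ A B C x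
      = rowU e₁ e₂ A B C x ^ 2 *
        (-2 * rowU e₁ e₂ A B C x * (rowH e₁ e₂ 2 B C x + rowH e₁ e₂ 1 B C x ^ 2 * rowU e₁ e₂ A B C x) ^ 3
          - ((e₁ : ℝ) + 1) ^ 2 * ((e₁ : ℝ) + e₂ + 2) ^ 2 * ((e₂ : ℝ) + 1) ^ 2 * (B * x ^ (e₁ + 1)) * (C * x ^ (e₁ + e₂ + 2))
            * (rowH e₁ e₂ 0 B C x * rowU e₁ e₂ A B C x + 1)) := by
  unfold rowPsi1 rowPsi2 rowPsi3 rowH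
  ring

/-- **Slope SOS** (every row): `ψ₁ψ₃ − ψ₂² = u²·βγp²q²(q−p)² + u³·(2γ³q⁶ + βγ²p²q²(6q² + (q−p)²) + β²γp²q²(6p² + (q−p)²) + 2β³p⁶)
+ 6H₁²H₂²u⁴ + 6H₁⁴H₂u⁵ + 2H₁⁶u⁶`. [this file's lemma] -/
theorem rowPsi_slope_sos (x : ℝ) :
    rowPsi1 e₁ e₂ A B C x * rowPsi3 e₁ e₂ A B C x - rowPsi2 e₁ e₂ A B C x ^ 2
      = rowU e₁ e₂ A B C x ^ 2 * ((B * x ^ (e₁ + 1)) * (C * x ^ (e₁ + e₂ + 2))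
            * (((e₁ : ℝ) + 1) ^ 2 * ((e₁ : ℝ) + e₂ + 2) ^ 2 * ((e₂ : ℝ) + 1) ^ 2))
        + rowU e₁ e₂ A B C x ^ 3 *
            (2 * (C * x ^ (e₁ + e₂ + 2)) ^ 3 * ((e₁ : ℝ) + e₂ + 2) ^ 6
              + (B * x ^ (e₁ + 1)) * (C * x ^ (e₁ + e₂ + 2)) ^ 2 * (((e₁ : ℝ) + 1) ^ 2 * ((e₁ : ℝ) + e₂ + 2) ^ 2
                  * (6 * ((e₁ : ℝ) + e₂ + 2) ^ 2 + ((e₂ : ℝ) + 1) ^ 2))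
              + (B * x ^ (e₁ + 1)) ^ 2 * (C * x ^ (e₁ + e₂ + 2)) * (((e₁ : ℝ) + 1) ^ 2 * ((e₁ : ℝ) + e₂ + 2) ^ 2
                  * (6 * ((e₁ : ℝ) + 1) ^ 2 + ((e₂ : ℝ) + 1) ^ 2))
              + 2 * (B * x ^ (e₁ + 1)) ^ 3 * ((e₁ : ℝ) + 1) ^ 6)
        + 6 * rowH e₁ e₂ 1 B C x ^ 2 * rowH e₁ e₂ 2 B C x ^ 2 * rowU e₁ e₂ A B C x ^ 4
        + 6 * rowH e₁ e₂ 1 B C x ^ 4 * rowH e₁ e₂ 2 B C x * rowU e₁ e₂ A B C x ^ 5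
        + 2 * rowH e₁ e₂ 1 B C x ^ 6 * rowU e₁ e₂ A B C x ^ 6 := by
  unfold rowPsi1 rowPsi2 rowPsi3 rowH
  ring

/-- ★ **PULLER: the slope `θψ` of an unswitched incoherent row is log-convex in `log x`:** `ψ₂² ≤ ψ₁·ψ₃`. [this file's theorem] -/
theorem puller_slope_logConvex {x : ℝ} (hx : 0 < x) (hB : 0 ≤ B) (hC : 0 ≤ C)
    (hF : 0 < A - B * x ^ (e₁ + 1) - C * x ^ (e₁ + e₂ + 2)) :
    rowPsi2 e₁ e₂ A B C x ^ 2 ≤ rowPsi1 e₁ e₂ A B C x * rowPsi3 e₁ e₂ A B C x := by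
  have hu := rowU_pos e₁ e₂ A B C hF
  have hH1 := rowH_nonneg e₁ e₂ B C 1 hx hB hC
  have hH2 := rowH_nonneg e₁ e₂ B C 2 hx hB hC
  have hβ : 0 ≤ B * x ^ (e₁ + 1) := by positivity
  have hγ : 0 ≤ C * x ^ (e₁ + e₂ + 2) := by positivity
  have h := rowPsi_slope_sos e₁ e₂ A B C x
  have hrhs : 0 ≤ rowU e₁ e₂ A B C x ^ 2 * ((B * x ^ (e₁ + 1)) * (C * x ^ (e₁ + e₂ + 2))
            * (((e₁ : ℝ) + 1) ^ 2 * ((e₁ : ℝ) + e₂ + 2) ^ 2 * ((e₂ : ℝ) + 1) ^ 2))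
        + rowU e₁ e₂ A B C x ^ 3 *
            (2 * (C * x ^ (e₁ + e₂ + 2)) ^ 3 * ((e₁ : ℝ) + e₂ + 2) ^ 6
              + (B * x ^ (e₁ + 1)) * (C * x ^ (e₁ + e₂ + 2)) ^ 2 * (((e₁ : ℝ) + 1) ^ 2 * ((e₁ : ℝ) + e₂ + 2) ^ 2
                  * (6 * ((e₁ : ℝ) + e₂ + 2) ^ 2 + ((e₂ : ℝ) + 1) ^ 2))
              + (B * x ^ (e₁ + 1)) ^ 2 * (C * x ^ (e₁ + e₂ + 2)) * (((e₁ : ℝ) + 1) ^ 2 * ((e₁ : ℝ) + e₂ + 2) ^ 2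
                  * (6 * ((e₁ : ℝ) + 1) ^ 2 + ((e₂ : ℝ) + 1) ^ 2))
              + 2 * (B * x ^ (e₁ + 1)) ^ 3 * ((e₁ : ℝ) + 1) ^ 6)
        + 6 * rowH e₁ e₂ 1 B C x ^ 2 * rowH e₁ e₂ 2 B C x ^ 2 * rowU e₁ e₂ A B C x ^ 4
        + 6 * rowH e₁ e₂ 1 B C x ^ 4 * rowH e₁ e₂ 2 B C x * rowU e₁ e₂ A B C x ^ 5
        + 2 * rowH e₁ e₂ 1 B C x ^ 6 * rowU e₁ e₂ A B C x ^ 6 := by positivity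
  linarith

/-- `H₀u + 1 = A·u` (the bottom weight): `(A − β − γ)·u = 1`. [folklore] -/
theorem rowH0_mul_rowU_add_one {x : ℝ} (hF : A - B * x ^ (e₁ + 1) - C * x ^ (e₁ + e₂ + 2) ≠ 0) :
    rowH e₁ e₂ 0 B C x * rowU e₁ e₂ A B C x + 1 = A * rowU e₁ e₂ A B C x := by
  unfold rowH rowU
  field_simp
  ring

/-- `ψ₁ = u·(H₂ + H₁²u)`. [folklore] -/
theorem rowPsi1_eq_mul (x : ℝ) :
    rowPsi1 e₁ e₂ A B C x = rowU e₁ e₂ A B C x * (rowH e₁ e₂ 2 B C x + rowH e₁ e₂ 1 B C x ^ 2 * rowU e₁ e₂ A B C x) := by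
  unfold rowPsi1; ring

/-- ★ **RISER: the slope of a switched incoherent riser is strictly log-concave past its turning point.**  `A ≥ 0`, `B, C ≥ 0`, the row
SWITCHED at `x > 0` (`A − Bx^p − Cx^q < 0`, so `u < 0`) and past its turning point (`ψ₁ < 0`, i.e. `s = θφ = −ψ₁ > 0`): then `ψ₁ψ₃ < ψ₂²`,
i.e. `s·θ²s < (θs)²`. [this file's theorem] -/
theorem riser_slope_logConcave {x : ℝ} (hx : 0 < x) (hA : 0 ≤ A) (hB : 0 ≤ B) (hC : 0 ≤ C)
    (hF : A - B * x ^ (e₁ + 1) - C * x ^ (e₁ + e₂ + 2) < 0) (hpost : rowPsi1 e₁ e₂ A B C x < 0) :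
    rowPsi1 e₁ e₂ A B C x * rowPsi3 e₁ e₂ A B C x < rowPsi2 e₁ e₂ A B C x ^ 2 := by
  have hu : rowU e₁ e₂ A B C x < 0 := by unfold rowU; exact inv_lt_zero.2 hF
  set u := rowU e₁ e₂ A B C x with hudef
  set E := rowH e₁ e₂ 2 B C x + rowH e₁ e₂ 1 B C x ^ 2 * u with hE
  -- `ψ₁ = u·E < 0` with `u < 0` forces `E > 0`
  have hE_pos : 0 < E := by
    have h1 : rowPsi1 e₁ e₂ A B C x = u * E := rowPsi1_eq_mul e₁ e₂ A B C x
    rw [h1] at hpost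
    by_contra hle
    push Not at hle
    have : 0 ≤ u * E := mul_nonneg_of_nonpos_of_nonpos hu.le hle
    linarith
  have hAu : rowH e₁ e₂ 0 B C x * u + 1 ≤ 0 := by
    rw [hudef, rowH0_mul_rowU_add_one e₁ e₂ A B C hF.ne]
    exact mul_nonpos_of_nonneg_of_nonpos hA hu.le
  have hβγ : 0 ≤ ((e₁ : ℝ) + 1) ^ 2 * ((e₁ : ℝ) + e₂ + 2) ^ 2 * ((e₂ : ℝ) + 1) ^ 2 * (B * x ^ (e₁ + 1))
      * (C * x ^ (e₁ + e₂ + 2)) := by positivity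
  have hcube : 0 < -2 * u * E ^ 3 := by
    have : 0 < -u := neg_pos.2 hu
    have hE3 : 0 < E ^ 3 := pow_pos hE_pos 3
    nlinarith
  have hterm2 : 0 ≤ -(((e₁ : ℝ) + 1) ^ 2 * ((e₁ : ℝ) + e₂ + 2) ^ 2 * ((e₂ : ℝ) + 1) ^ 2 * (B * x ^ (e₁ + 1))
      * (C * x ^ (e₁ + e₂ + 2)) * (rowH e₁ e₂ 0 B C x * u + 1)) := by
    have := mul_nonpos_of_nonneg_of_nonpos hβγ hAu
    linarith
  have hu2 : 0 < u ^ 2 := by have h := mul_pos (neg_pos.2 hu) (neg_pos.2 hu); nlinarith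
  have hid := rowPsi_slope_identity e₁ e₂ A B C x
  rw [← hudef, ← hE] at hid
  have hbr : 0 < -2 * u * E ^ 3
      - ((e₁ : ℝ) + 1) ^ 2 * ((e₁ : ℝ) + e₂ + 2) ^ 2 * ((e₂ : ℝ) + 1) ^ 2 * (B * x ^ (e₁ + 1)) * (C * x ^ (e₁ + e₂ + 2))
          * (rowH e₁ e₂ 0 B C x * u + 1) := by linarith
  have : 0 < rowPsi2 e₁ e₂ A B C x ^ 2 - rowPsi1 e₁ e₂ A B C x * rowPsi3 e₁ e₂ A B C x := by
    rw [hid]; exact mul_pos hu2 hbr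
  linarith

/-- `H₁·ψ₂ = u(H₁H₃ − H₂²) + u(H₂ + H₁²u)(H₂ + 2H₁²u)`: at a turning point (`H₂ + H₁²u = 0`) the slope's slope is `u(H₁H₃ − H₂²)/H₁`. [folklore] -/
theorem rowH1_mul_rowPsi2 (x : ℝ) :
    rowH e₁ e₂ 1 B C x * rowPsi2 e₁ e₂ A B C x
      = rowU e₁ e₂ A B C x * (rowH e₁ e₂ 1 B C x * rowH e₁ e₂ 3 B C x - rowH e₁ e₂ 2 B C x ^ 2)
        + rowU e₁ e₂ A B C x * (rowH e₁ e₂ 2 B C x + rowH e₁ e₂ 1 B C x ^ 2 * rowU e₁ e₂ A B C x)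
          * (rowH e₁ e₂ 2 B C x + 2 * rowH e₁ e₂ 1 B C x ^ 2 * rowU e₁ e₂ A B C x) := by
  unfold rowPsi2; ring

/-- `H₁H₃ − H₂² = βγ·pq(q−p)²` (strictly positive for a genuine two-letter row at `x > 0`). [folklore] -/
theorem rowH_det13 (x : ℝ) :
    rowH e₁ e₂ 1 B C x * rowH e₁ e₂ 3 B C x - rowH e₁ e₂ 2 B C x ^ 2
      = (B * x ^ (e₁ + 1)) * (C * x ^ (e₁ + e₂ + 2)) * (((e₁ : ℝ) + 1) * ((e₁ : ℝ) + e₂ + 2) * ((e₂ : ℝ) + 1) ^ 2) := by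
  unfold rowH; ring
/-! ### §2 The riser's turning is permanent -/

/-- ★ **Turning persistence.**  Riser `A − Bx^p − Cx^q` with `B, C > 0`, switched on `[x₁, x₂] ⊂ (0,∞)`; if `ψ₁(x₁) ≤ 0` (at or past the turning
point) then `ψ₁ < 0` on `(x₁, x₂]`: the function `M = −ψ₁/(H₁u²) = (m − φ)·h` has derivative `(H₁H₃ − H₂²)/(H₁²·(−u)·x) > 0`.
[this file's theorem] -/
theorem riser_turning_persist (hB : 0 < B) (hC : 0 < C) {x₁ x₂ : ℝ} (h0 : 0 < x₁) (h12 : x₁ ≤ x₂)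
    (hsw : ∀ x ∈ Set.Icc x₁ x₂, A - B * x ^ (e₁ + 1) - C * x ^ (e₁ + e₂ + 2) < 0)
    (hstart : rowPsi1 e₁ e₂ A B C x₁ ≤ 0) :
    ∀ x ∈ Set.Ioc x₁ x₂, rowPsi1 e₁ e₂ A B C x < 0 := by
  -- the monotone function `M = −ψ₁ /(H₁ u²)`
  set M : ℝ → ℝ := fun t => -rowPsi1 e₁ e₂ A B C t / (rowH e₁ e₂ 1 B C t * rowU e₁ e₂ A B C t ^ 2) with hM
  have hx0 : ∀ x ∈ Set.Icc x₁ x₂, 0 < x := fun x hx => h0.trans_le hx.1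
  have hH1pos : ∀ x ∈ Set.Icc x₁ x₂, 0 < rowH e₁ e₂ 1 B C x := fun x hx =>
    rowH_one_pos e₁ e₂ B C (hx0 x hx) hB.le hC.le (by linarith)
  have hu_neg : ∀ x ∈ Set.Icc x₁ x₂, rowU e₁ e₂ A B C x < 0 := fun x hx => by
    unfold rowU; exact inv_lt_zero.2 (hsw x hx)
  -- derivative of `M`
  have hderiv : ∀ x ∈ Set.Icc x₁ x₂, ∃ D : ℝ, 0 < D ∧ HasDerivAt M D x := by
    intro x hx
    have hx' := hx0 x hx
    have hFne := (hsw x hx).ne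
    have hψ := hasDerivAt_rowPsi1 e₁ e₂ A B C hx'.ne' hFne
    have hH1 : HasDerivAt (fun t => rowH e₁ e₂ 1 B C t) (rowH e₁ e₂ 2 B C x / x) x := by
      have h := hasDerivAt_Hk e₁ e₂ (((e₁ : ℝ) + 1) * B) (((e₁ : ℝ) + e₂ + 2) * C) hx'.ne'
      refine (h.congr_of_eventuallyEq (Filter.Eventually.of_forall fun t => ?_)).congr_deriv ?_
      · simp only [rowH, pow_one]
      · simp only [rowH]; ring
    have hu : HasDerivAt (fun t => rowU e₁ e₂ A B C t) (rowH e₁ e₂ 1 B C x / x * rowU e₁ e₂ A B C x ^ 2) x := by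
      have h := hasDerivAt_uInv e₁ e₂ A B C hx'.ne' hFne
      refine (h.congr_of_eventuallyEq (Filter.Eventually.of_forall fun t => ?_)).congr_deriv ?_
      · simp only [rowU]
      · simp only [rowH, rowU, pow_one]
    have hden := hH1.mul (hu.pow 2)
    have hden_ne : rowH e₁ e₂ 1 B C x * rowU e₁ e₂ A B C x ^ 2 ≠ 0 :=
      mul_ne_zero (hH1pos x hx).ne' (pow_ne_zero 2 (hu_neg x hx).ne)
    have hMd := (hψ.neg.div hden hden_ne)
    -- the value of the derivative
    have hkey := rowH1_mul_rowPsi2 e₁ e₂ A B C x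
    have hψ1 := rowPsi1_eq_mul e₁ e₂ A B C x
    have hdet : 0 < rowH e₁ e₂ 1 B C x * rowH e₁ e₂ 3 B C x - rowH e₁ e₂ 2 B C x ^ 2 := by
      rw [rowH_det13]
      have hβ : 0 < B * x ^ (e₁ + 1) := by positivity
      have hγ : 0 < C * x ^ (e₁ + e₂ + 2) := by positivity
      positivity
    have hH1x := hH1pos x hx
    have hux := hu_neg x hx
    refine ⟨(rowH e₁ e₂ 1 B C x * rowH e₁ e₂ 3 B C x - rowH e₁ e₂ 2 B C x ^ 2)
        / (rowH e₁ e₂ 1 B C x ^ 2 * (-rowU e₁ e₂ A B C x) * x), by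
      have : 0 < -rowU e₁ e₂ A B C x := neg_pos.2 hux
      positivity, ?_⟩
    refine hMd.congr_deriv ?_
    have hune : rowU e₁ e₂ A B C x ≠ 0 := hux.ne
    have hH1ne : rowH e₁ e₂ 1 B C x ≠ 0 := hH1x.ne'
    have hxne : x ≠ 0 := hx'.ne'
    have e2 : rowPsi2 e₁ e₂ A B C x
        = (rowU e₁ e₂ A B C x * (rowH e₁ e₂ 1 B C x * rowH e₁ e₂ 3 B C x - rowH e₁ e₂ 2 B C x ^ 2)
          + rowU e₁ e₂ A B C x * (rowH e₁ e₂ 2 B C x + rowH e₁ e₂ 1 B C x ^ 2 * rowU e₁ e₂ A B C x)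
            * (rowH e₁ e₂ 2 B C x + 2 * rowH e₁ e₂ 1 B C x ^ 2 * rowU e₁ e₂ A B C x)) / rowH e₁ e₂ 1 B C x := by
      rw [← hkey]; field_simp
    simp only [Pi.mul_apply, Pi.pow_apply, Pi.neg_apply]
    rw [e2, hψ1]
    field_simp
    ring
  -- `M` is strictly increasing on the interval
  have hcont : ContinuousOn M (Set.Icc x₁ x₂) := fun x hx => by
    obtain ⟨D, _, hD⟩ := hderiv x hx; exact hD.continuousAt.continuousWithinAt
  have hmono : StrictMonoOn M (Set.Icc x₁ x₂) := by
    refine strictMonoOn_of_deriv_pos (convex_Icc x₁ x₂) hcont fun x hx => ?_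
    rw [interior_Icc] at hx
    obtain ⟨D, hDpos, hD⟩ := hderiv x ⟨hx.1.le, hx.2.le⟩
    rw [hD.deriv]; exact hDpos
  -- sign bookkeeping: `M > 0 ↔ ψ₁ < 0`
  have hM1 : 0 ≤ M x₁ := by
    simp only [hM]
    have hx1 : x₁ ∈ Set.Icc x₁ x₂ := ⟨le_rfl, h12⟩
    have hden : 0 < rowH e₁ e₂ 1 B C x₁ * rowU e₁ e₂ A B C x₁ ^ 2 :=
      mul_pos (hH1pos x₁ hx1) (by have := (hu_neg x₁ hx1).ne; positivity)
    exact div_nonneg (neg_nonneg.2 hstart) hden.le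
  intro x hx
  have hx' : x ∈ Set.Icc x₁ x₂ := ⟨hx.1.le, hx.2⟩
  have hMx : 0 < M x := hM1.trans_lt (hmono ⟨le_rfl, h12⟩ hx' hx.1)
  simp only [hM] at hMx
  have hden : 0 < rowH e₁ e₂ 1 B C x * rowU e₁ e₂ A B C x ^ 2 :=
    mul_pos (hH1pos x hx') (by have := (hu_neg x hx').ne; positivity)
  have := (div_pos_iff_of_pos_right hden).1 hMx
  linarith

end Row

/-! ### §3 The cloud's slope is log-convex -/

section Cloud

variable (e₁ e₂ : ℕ) {ι : Type*} {s : Finset ι} {m A B C : ι → ℝ}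

/-- `θ³ψ ≥ 0` for an unswitched row with `B, C ≥ 0`, `x > 0`. [folklore] -/
theorem rowPsi3_nonneg {A B C : ℝ} {x : ℝ} (hx : 0 < x) (hB : 0 ≤ B) (hC : 0 ≤ C)
    (hF : 0 < A - B * x ^ (e₁ + 1) - C * x ^ (e₁ + e₂ + 2)) : 0 ≤ rowPsi3 e₁ e₂ A B C x := by
  have hu := rowU_pos e₁ e₂ A B C hF
  have h1 := rowH_nonneg e₁ e₂ B C 1 hx hB hC; have h2 := rowH_nonneg e₁ e₂ B C 2 hx hB hC
  have h3 := rowH_nonneg e₁ e₂ B C 3 hx hB hC; have h4 := rowH_nonneg e₁ e₂ B C 4 hx hB hC; unfold rowPsi3; positivity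

/-- ★ **The cloud's slope `n = cloudP1 = θΠ` is log-convex in `log x`:** `cloudP2² ≤ cloudP1·cloudP3`. [this file's theorem] -/
theorem cloud_lcP1 {x : ℝ} (hx : 0 < x) (hm : ∀ i ∈ s, 0 < m i) (hB : ∀ i ∈ s, 0 ≤ B i) (hC : ∀ i ∈ s, 0 ≤ C i)
    (hBC : ∀ i ∈ s, 0 < B i + C i) (hF : ∀ i ∈ s, 0 < A i - B i * x ^ (e₁ + 1) - C i * x ^ (e₁ + e₂ + 2)) :
    cloudP2 e₁ e₂ s m A B C x ^ 2 ≤ cloudP1 e₁ e₂ s m A B C x * cloudP3 e₁ e₂ s m A B C x := by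
  unfold cloudP1 cloudP2 cloudP3
  refine lc_sum s _ _ _ (fun i hi => mul_nonneg (hm i hi).le
      (rowPsi_signs e₁ e₂ (A i) (B i) (C i) hx (hB i hi) (hC i hi) (hBC i hi) (hF i hi)).2.1.le)
    (fun i hi => mul_nonneg (hm i hi).le (rowPsi3_nonneg e₁ e₂ hx (hB i hi) (hC i hi) (hF i hi))) ?_
  intro i hi
  have h := puller_slope_logConvex e₁ e₂ (A i) (B i) (C i) hx (hB i hi) (hC i hi) (hF i hi)
  have hm2 : 0 ≤ m i ^ 2 := sq_nonneg _
  calc (m i * rowPsi2 e₁ e₂ (A i) (B i) (C i) x) ^ 2 = m i ^ 2 * rowPsi2 e₁ e₂ (A i) (B i) (C i) x ^ 2 := by ring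
    _ ≤ m i ^ 2 * (rowPsi1 e₁ e₂ (A i) (B i) (C i) x * rowPsi3 e₁ e₂ (A i) (B i) (C i) x) := mul_le_mul_of_nonneg_left h hm2
    _ = m i * rowPsi1 e₁ e₂ (A i) (B i) (C i) x * (m i * rowPsi3 e₁ e₂ (A i) (B i) (C i) x) := by ring

end Cloud

/-! ### §4 The ρ_I = 1 cell in W-currency: at most two zeros of the slope -/

/-- ★★ **ONE SWITCHED INCOHERENT RISER AGAINST ANY INCOHERENT CLOUD ⇒ `θΦ = s − n` HAS NO THREE ZEROS.**
`p = e₁+1 < q = e₁+e₂+2`; riser `a − b x^p − c x^q` with `0 ≤ a`, `0 < b`, `0 < c`, SWITCHED (`a − b x^p − c x^q < 0`) on `[x₁, x₃] ⊂ (0,∞)`; nonempty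
cloud `s`, weights `m_i > 0`, letters `B_i, C_i ≥ 0` with `B_i + C_i > 0`, UNSWITCHED (`A_i − B_i x^p − C_i x^q > 0`) on the interval.  Then
`rowPsi1 (riser) + cloudP1` (`= −(s − n) = −W(P)/P²`) does not vanish at three points `x₁ < x₂ < x₃`. [this file's theorem] -/
theorem oneRiser_slope_no_three_zeros (e₁ e₂ : ℕ) {a b c : ℝ} (ha : 0 ≤ a) (hb : 0 < b) (hc : 0 < c)
    {ι : Type*} (s : Finset ι) (hs : s.Nonempty) (m A B C : ι → ℝ) (hm : ∀ i ∈ s, 0 < m i)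
    (hB : ∀ i ∈ s, 0 ≤ B i) (hC : ∀ i ∈ s, 0 ≤ C i) (hBC : ∀ i ∈ s, 0 < B i + C i)
    {x₁ x₂ x₃ : ℝ} (h0 : 0 < x₁) (h12 : x₁ < x₂) (h23 : x₂ < x₃)
    (hsw : ∀ x ∈ Set.Icc x₁ x₃, a - b * x ^ (e₁ + 1) - c * x ^ (e₁ + e₂ + 2) < 0)
    (hun : ∀ x ∈ Set.Icc x₁ x₃, ∀ i ∈ s, 0 < A i - B i * x ^ (e₁ + 1) - C i * x ^ (e₁ + e₂ + 2))
    (hzero : ∀ x ∈ ({x₁, x₂, x₃} : Set ℝ), rowPsi1 e₁ e₂ a b c x + cloudP1 e₁ e₂ s m A B C x = 0) : False := by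
  have hx0 : ∀ x ∈ Set.Icc x₁ x₃, 0 < x := fun x hx => h0.trans_le hx.1
  have hsig := fun x (hx : x ∈ Set.Icc x₁ x₃) => cloud_signs e₁ e₂ (hx0 x hx) hs hm hB hC hBC (hun x hx)
  have hI1 : x₁ ∈ Set.Icc x₁ x₃ := ⟨le_rfl, (h12.trans h23).le⟩
  have hI2 : x₂ ∈ Set.Icc x₁ x₃ := ⟨h12.le, h23.le⟩
  have hI3 : x₃ ∈ Set.Icc x₁ x₃ := ⟨(h12.trans h23).le, le_rfl⟩
  -- the riser is past its turning point at `x₁`, hence on the whole window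
  have hz1 := hzero x₁ (by simp)
  have hstart : rowPsi1 e₁ e₂ a b c x₁ < 0 := by linarith [(hsig x₁ hI1).2.1]
  have hpost : ∀ x ∈ Set.Icc x₁ x₃, rowPsi1 e₁ e₂ a b c x < 0 := fun x hx =>
    (eq_or_lt_of_le hx.1).elim (fun h => h ▸ hstart)
      (fun h => riser_turning_persist e₁ e₂ a b c hb hc h0 (h12.trans h23).le hsw hstart.le x ⟨h, hx.2⟩)
  -- `F = log(−ψ₁) − log P1` vanishes at the three points
  have hFzero : ∀ x ∈ ({x₁, x₂, x₃} : Set ℝ),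
      Real.log (-rowPsi1 e₁ e₂ a b c x) - Real.log (cloudP1 e₁ e₂ s m A B C x) = 0 := by
    intro x hx
    have h := hzero x hx
    have : -rowPsi1 e₁ e₂ a b c x = cloudP1 e₁ e₂ s m A B C x := by linarith
    rw [this, sub_self]
  have hFderiv : ∀ x ∈ Set.Icc x₁ x₃,
      HasDerivAt (fun t => Real.log (-rowPsi1 e₁ e₂ a b c t) - Real.log (cloudP1 e₁ e₂ s m A B C t))
        ((rowPsi2 e₁ e₂ a b c x / rowPsi1 e₁ e₂ a b c x - cloudP2 e₁ e₂ s m A B C x / cloudP1 e₁ e₂ s m A B C x) / x) x := by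
    intro x hx
    have hx' := hx0 x hx
    have h1 : HasDerivAt (fun t => -rowPsi1 e₁ e₂ a b c t) (-(rowPsi2 e₁ e₂ a b c x / x)) x :=
      (hasDerivAt_rowPsi1 e₁ e₂ a b c hx'.ne' (hsw x hx).ne).neg
    have h1' := h1.log (by have := hpost x hx; linarith)
    have h2 := (cloud_hasDerivAt1 e₁ e₂ s m A B C hx' (hun x hx)).log (hsig x hx).2.1.ne'
    refine (h1'.sub h2).congr_deriv ?_
    have hψ1ne : rowPsi1 e₁ e₂ a b c x ≠ 0 := (hpost x hx).ne
    have hP1ne : cloudP1 e₁ e₂ s m A B C x ≠ 0 := (hsig x hx).2.1.ne'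
    have hxne : x ≠ 0 := hx'.ne'
    field_simp
  have hFcont : ∀ y z, x₁ ≤ y → z ≤ x₃ →
      ContinuousOn (fun t => Real.log (-rowPsi1 e₁ e₂ a b c t) - Real.log (cloudP1 e₁ e₂ s m A B C t)) (Set.Icc y z) :=
    fun y z hy hz t ht => (hFderiv t ⟨hy.trans ht.1, ht.2.trans hz⟩).continuousAt.continuousWithinAt
  -- Rolle twice: zeros `η₁ < η₂` of `G = ψ₂/ψ₁ − P2/P1`
  have hrolle : ∀ y z, x₁ ≤ y → y < z → z ≤ x₃ →
      Real.log (-rowPsi1 e₁ e₂ a b c y) - Real.log (cloudP1 e₁ e₂ s m A B C y) = 0 →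
      Real.log (-rowPsi1 e₁ e₂ a b c z) - Real.log (cloudP1 e₁ e₂ s m A B C z) = 0 →
        ∃ η ∈ Set.Ioo y z, rowPsi2 e₁ e₂ a b c η / rowPsi1 e₁ e₂ a b c η
          - cloudP2 e₁ e₂ s m A B C η / cloudP1 e₁ e₂ s m A B C η = 0 := by
    intro y z hy hyz hz hFy hFz
    obtain ⟨η, hη, hη'⟩ := exists_hasDerivAt_eq_zero hyz (hFcont y z hy hz) (hFy.trans hFz.symm)
      (fun t ht => hFderiv t ⟨hy.trans ht.1.le, ht.2.le.trans hz⟩)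
    refine ⟨η, hη, ?_⟩
    have hη0 : 0 < η := hx0 η ⟨hy.trans hη.1.le, hη.2.le.trans hz⟩
    rcases div_eq_zero_iff.1 hη' with h | h
    · exact h
    · exact absurd h hη0.ne'
  obtain ⟨η₁, hη₁, hG1⟩ := hrolle x₁ x₂ le_rfl h12 h23.le (hFzero x₁ (by simp)) (hFzero x₂ (by simp))
  obtain ⟨η₂, hη₂, hG2⟩ := hrolle x₂ x₃ h12.le h23 le_rfl (hFzero x₂ (by simp)) (hFzero x₃ (by simp))
  have hη12 : η₁ < η₂ := hη₁.2.trans hη₂.1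
  -- `G` has a negative derivative on the window
  have hGderiv : ∀ x ∈ Set.Icc x₁ x₃, ∃ D : ℝ, D < 0 ∧
      HasDerivAt (fun t => rowPsi2 e₁ e₂ a b c t / rowPsi1 e₁ e₂ a b c t
        - cloudP2 e₁ e₂ s m A B C t / cloudP1 e₁ e₂ s m A B C t) D x := by
    intro x hx
    have hx' := hx0 x hx
    have hψ1x : rowPsi1 e₁ e₂ a b c x < 0 := hpost x hx
    have hP1x : 0 < cloudP1 e₁ e₂ s m A B C x := (hsig x hx).2.1
    have d1 := hasDerivAt_rowPsi1 e₁ e₂ a b c hx'.ne' (hsw x hx).ne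
    have d2 := hasDerivAt_rowPsi2 e₁ e₂ a b c hx'.ne' (hsw x hx).ne
    have c1 := cloud_hasDerivAt1 e₁ e₂ s m A B C hx' (hun x hx)
    have c2 := cloud_hasDerivAt2 e₁ e₂ s m A B C hx' (hun x hx)
    have hquot := (d2.div d1 hψ1x.ne).sub (c2.div c1 hP1x.ne')
    have hris := riser_slope_logConcave e₁ e₂ a b c hx' ha hb.le hc.le (hsw x hx) hψ1x
    have hcl := cloud_lcP1 e₁ e₂ hx' hm hB hC hBC (hun x hx)
    refine ⟨(rowPsi3 e₁ e₂ a b c x * rowPsi1 e₁ e₂ a b c x - rowPsi2 e₁ e₂ a b c x ^ 2) / (x * rowPsi1 e₁ e₂ a b c x ^ 2)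
        - (cloudP3 e₁ e₂ s m A B C x * cloudP1 e₁ e₂ s m A B C x - cloudP2 e₁ e₂ s m A B C x ^ 2)
          / (x * cloudP1 e₁ e₂ s m A B C x ^ 2), ?_, ?_⟩
    · have t1 : (rowPsi3 e₁ e₂ a b c x * rowPsi1 e₁ e₂ a b c x - rowPsi2 e₁ e₂ a b c x ^ 2)
          / (x * rowPsi1 e₁ e₂ a b c x ^ 2) < 0 :=
        div_neg_of_neg_of_pos (by linarith) (mul_pos hx' (sq_pos_iff.mpr hψ1x.ne))
      have t2 : 0 ≤ (cloudP3 e₁ e₂ s m A B C x * cloudP1 e₁ e₂ s m A B C x - cloudP2 e₁ e₂ s m A B C x ^ 2)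
          / (x * cloudP1 e₁ e₂ s m A B C x ^ 2) :=
        div_nonneg (by linarith) (by positivity)
      linarith
    · refine (hquot.congr_of_eventuallyEq (Filter.Eventually.of_forall fun t => ?_)).congr_deriv ?_
      · simp only [Pi.sub_apply, Pi.div_apply]
      · have hψ1ne : rowPsi1 e₁ e₂ a b c x ≠ 0 := hψ1x.ne
        have hP1ne : cloudP1 e₁ e₂ s m A B C x ≠ 0 := hP1x.ne'
        have hxne : x ≠ 0 := hx'.ne'
        field_simp
  -- mean value between `η₁` and `η₂` contradicts `G η₁ = G η₂ = 0`
  have hGcont : ContinuousOn (fun t => rowPsi2 e₁ e₂ a b c t / rowPsi1 e₁ e₂ a b c t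
      - cloudP2 e₁ e₂ s m A B C t / cloudP1 e₁ e₂ s m A B C t) (Set.Icc η₁ η₂) := fun t ht => by
    obtain ⟨D, _, hD⟩ := hGderiv t ⟨hη₁.1.le.trans ht.1, ht.2.trans hη₂.2.le⟩
    exact hD.continuousAt.continuousWithinAt
  obtain ⟨ξ, hξ, hξ'⟩ := exists_deriv_eq_slope _ hη12 hGcont (fun t ht => by
    obtain ⟨D, _, hD⟩ := hGderiv t ⟨hη₁.1.le.trans ht.1.le, ht.2.le.trans hη₂.2.le⟩
    exact hD.differentiableAt.differentiableWithinAt)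
  obtain ⟨D, hDneg, hD⟩ := hGderiv ξ ⟨hη₁.1.le.trans hξ.1.le, hξ.2.le.trans hη₂.2.le⟩
  rw [hD.deriv, hG1, hG2, sub_zero, zero_div] at hξ'
  exact hDneg.ne hξ'

end ProductPlusOne

end Summit.ValiantsHypothesis.ValiantsHypothesis.Theorems.LacunarySymmetroidMatrixDescartes
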